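/-
Origin: expansion seat `planner-pub-hodgecm-landherr-g7-0`, handover #1 2026-08-18T06:49:30Z (`HOME/pub-hodgecm-landherr-g7/lean/LandherrG7/LandherrRankN.lean`, md5 4961e59b, 821 lines);
landed by the gen-7 packager in gate run 25 as `HodgeCM/Proofs/LandherrRankN.lean` (verbatim).
-/
/-
Copyright: pub-hodgecm formalisation cell (harness21, 2026). New file (not vendored).
Origin: HOME/pub-hodgecm-landherr-g7/lean/LandherrG7/LandherrRankN.lean — session planner-pub-hodgecm-landherr-g7-0
(unit pub-hodgecm-landherr-g7, EXPANSION part (c) `Lemma33bLandherr`, gen 7).  Intended final place: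
`HodgeCM/Proofs/LandherrRankN.lean` (imports only landed modules; nothing in the package depends on it).
-/
import Summits.HodgeConjecture.HodgeCM.Literature.NormTheoremHolds
import Summits.HodgeConjecture.HodgeCM.Proofs.LandherrNecessity
import Summits.HodgeConjecture.HodgeCM.Proofs.SignPattern

set_option autoImplicit false

/-!
# Landherr's theorem for diagonal hermitian forms of ARBITRARY rank over a CM field

`HodgeCM.Lemma33bLandherr` (typed target, `StubTree/Inputs.lean`; a THEOREM since gate run 22:
`HodgeCM.lemma33bLandherr_holds`) is Landherr's classification [La36] for diagonal hermitian PLANES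
`⟨a₀, a₁⟩ ≅ ⟨a₂, a₃⟩` over a CM field `L` (relative to `L/L₀`, `σ` = complex conjugation), which is all that
PerL v5 (tex ll. 299–300) consumes.  The printed theorem (Landherr 1936; Shimura, *Arithmetic of hermitian
forms*, Doc. Math. 13 (2008) Thm. 2.2 (i) p. 748: "The isomorphism class of (V, φ) is determined by n, {σ_v},
and d₀(φ)"; Rogawski 1990 §1.9; Scharlau Ch. 10 Ex. 1.6 (ii)) is about hermitian spaces of every rank `n`.

This file proves the rank-`n` statement for diagonal Gram matrices over an arbitrary finite index type `ι`
(every non-degenerate hermitian form is diagonalisable, so nothing is lost):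

* `HodgeCM.landherr_diagonal_iff` — for `a a' : ι → L` with `σ aᵢ = aᵢ ≠ 0`, `σ a'ᵢ = a'ᵢ ≠ 0`:
  `(∃ g : GL ι L, ᵗ(σ g) · diag a · g = diag a') ↔
   (∀ τ : L →+* ℂ, #{i | τ aᵢ > 0} = #{i | τ a'ᵢ > 0}) ∧ ∃ z ≠ 0, ∏ aᵢ = (∏ a'ᵢ) · z σz`,
  i.e. classification by rank, the signatures at the real places of `L₀` and the discriminant in
  `L₀^× / N_{L/L₀}(L^×)`; `HodgeCM.landherr_rank_iff` is the same over `Fin n`.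

NO arithmetic input beyond the rank-2 theorem is used: the proof is an induction on the rank whose only
ingredients are (1) `lemma33bLandherr_holds` (rank 2), in the form "a binary diagonal form `⟨b₁, b₂⟩`
represents every `c ∈ L₀^×` whose sign at each real place is the common sign of `b₁, b₂` wherever these agree,
with diagonal complement: `⟨b₁, b₂⟩ ≅ ⟨b₁b₂/c, c⟩`"; (2) weak approximation for signs in `L₀`
(`HodgeCM.exists_isReal_signs`, package, from Dirichlet's unit theorem); (3) block-matrix algebra; and, for the
converse, (4) Sylvester's law of inertia for hermitian forms over `ℂ`, proved here from a kernel-dimension count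
(`LinearMap.ker_ne_bot_of_finrank_lt`).  Closure of every theorem: the standard trio (via `lemma33bLandherr_holds`).

Structure: §1 `σ`-conjugate transpose and the isometry relation `IsomDiag` on diagonal forms (refl/symm/trans,
reindexing, orthogonal sums); §2 invariants of an isometry (discriminant class; positive index at each `τ` =
inertia, `card_pos_le_of_congr`); §3 real signs of `σ`-fixed elements and the binary move from the rank-2
theorem; §4 representation of a compatible scalar with diagonal complement (`rep_step`), by induction on the rank;
§5 sufficiency of the invariants (`isomDiag_of_invariants`), by induction on the rank; §6 the theorem in `GL` form
over any finite index type (`landherr_diagonal_iff`) and over `Fin n` (`landherr_rank_iff`), and the check that its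
case `n = 2` is, word for word, the statement of `Literature.landherr_rank2_iff` (`landherr_rank2_iff_of_rankN`).
-/

noncomputable section

open NumberField
open scoped Matrix

namespace HodgeCM

open Literature.AlgebraicGeometry.ShimuraVarieties (conjRingHomK embedding_conjRingHomK)

namespace LandherrRankN

variable (L : CMField)

/-! ## §1. Conjugate transpose and isometry of diagonal hermitian forms -/

section Algebra

variable {ι κ μ : Type}

/-- `ᵗ(σ A)`: transpose followed by complex conjugation of the CM field `L` entrywise. -/
def cT (A : Matrix ι κ L) : Matrix κ ι L := A.transpose.map (conjRingHomK L)

/-- (Ported verbatim from the HodgeCMPerL package; no docstring in the source.) -/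
theorem cT_apply (A : Matrix ι κ L) (i : κ) (j : ι) : cT L A i j = conjRingHomK L (A j i) := rfl

/-- (Ported verbatim from the HodgeCMPerL package; no docstring in the source.) -/
theorem cT_mul [Fintype μ] (A : Matrix ι μ L) (B : Matrix μ κ L) : cT L (A * B) = cT L B * cT L A := by
  unfold cT
  rw [Matrix.transpose_mul, Matrix.map_mul]

/-- (Ported verbatim from the HodgeCMPerL package; no docstring in the source.) -/
theorem cT_one [DecidableEq ι] : cT L (1 : Matrix ι ι L) = 1 := by
  unfold cT
  rw [Matrix.transpose_one, Matrix.map_one _ (map_zero _) (map_one _)]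

/-- (Ported verbatim from the HodgeCMPerL package; no docstring in the source.) -/
theorem cT_zero : cT L (0 : Matrix ι κ L) = 0 := by
  unfold cT
  rw [Matrix.transpose_zero, Matrix.map_zero _ (map_zero _)]

/-- (Ported verbatim from the HodgeCMPerL package; no docstring in the source.) -/
theorem det_cT [Fintype ι] [DecidableEq ι] (A : Matrix ι ι L) : (cT L A).det = conjRingHomK L A.det := by
  unfold cT
  rw [← RingHom.mapMatrix_apply, ← RingHom.map_det, Matrix.det_transpose]

/-- (Ported verbatim from the HodgeCMPerL package; no docstring in the source.) -/
theorem cT_submatrix (A : Matrix ι ι L) (e : κ → ι) (f : κ → ι) :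
    cT L (A.submatrix e f) = (cT L A).submatrix f e := by
  unfold cT
  rw [Matrix.transpose_submatrix, Matrix.submatrix_map]

/-- (Ported verbatim from the HodgeCMPerL package; no docstring in the source.) -/
theorem cT_fromBlocks (A : Matrix ι ι L) (B : Matrix ι κ L) (C : Matrix κ ι L) (D : Matrix κ κ L) :
    cT L (Matrix.fromBlocks A B C D) = Matrix.fromBlocks (cT L A) (cT L C) (cT L B) (cT L D) := by
  unfold cT
  rw [Matrix.fromBlocks_transpose, Matrix.fromBlocks_map]

/-- The map `τ` of an `L`-matrix: `τ(ᵗσA) = (τA)ᴴ`. -/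
theorem map_cT (τ : L →+* ℂ) (A : Matrix ι κ L) : (cT L A).map τ = (A.map τ)ᴴ := by
  ext i j
  simp [cT, Matrix.conjTranspose_apply, embedding_conjRingHomK]

variable [Fintype ι] [DecidableEq ι]

/-- **Isometry of diagonal hermitian forms.**  `IsomDiag L b b'` (`b b' : ι → L`): there is an invertible
`G` with `ᵗ(σG) · diag b · G = diag b'`, i.e. the hermitian forms `∑ bᵢ xᵢ σ(yᵢ)` and `∑ b'ᵢ xᵢ σ(yᵢ)` on `L^ι`
are isometric. -/
def IsomDiag (b b' : ι → L) : Prop :=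
  ∃ G : Matrix ι ι L, IsUnit G.det ∧ cT L G * Matrix.diagonal b * G = Matrix.diagonal b'

namespace IsomDiag

/-- (Ported verbatim from the HodgeCMPerL package; no docstring in the source.) -/
theorem refl (b : ι → L) : IsomDiag L b b :=
  ⟨1, by simp, by rw [cT_one, Matrix.one_mul, Matrix.mul_one]⟩

variable {L}

/-- (Ported verbatim from the HodgeCMPerL package; no docstring in the source.) -/
theorem of_eq {b b' : ι → L} (h : b = b') : IsomDiag L b b' := h ▸ refl L b

/-- (Ported verbatim from the HodgeCMPerL package; no docstring in the source.) -/
theorem trans {b b' b'' : ι → L} (h₁ : IsomDiag L b b') (h₂ : IsomDiag L b' b'') : IsomDiag L b b'' := by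
  obtain ⟨G₁, hG₁, e₁⟩ := h₁
  obtain ⟨G₂, hG₂, e₂⟩ := h₂
  refine ⟨G₁ * G₂, by rw [Matrix.det_mul]; exact hG₁.mul hG₂, ?_⟩
  calc cT L (G₁ * G₂) * Matrix.diagonal b * (G₁ * G₂)
      = cT L G₂ * (cT L G₁ * Matrix.diagonal b * G₁) * G₂ := by
        rw [cT_mul]; simp only [Matrix.mul_assoc]
    _ = Matrix.diagonal b'' := by rw [e₁, e₂]

/-- (Ported verbatim from the HodgeCMPerL package; no docstring in the source.) -/
theorem symm {b b' : ι → L} (h : IsomDiag L b b') : IsomDiag L b' b := by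
  obtain ⟨G, hG, e⟩ := h
  refine ⟨G⁻¹, Matrix.isUnit_nonsing_inv_det G hG, ?_⟩
  have h1 : cT L G⁻¹ * cT L G = 1 := by rw [← cT_mul, Matrix.mul_nonsing_inv G hG, cT_one]
  calc cT L G⁻¹ * Matrix.diagonal b' * G⁻¹
      = cT L G⁻¹ * (cT L G * Matrix.diagonal b * G) * G⁻¹ := by rw [e]
    _ = (cT L G⁻¹ * cT L G) * Matrix.diagonal b * (G * G⁻¹) := by
        simp only [Matrix.mul_assoc]
    _ = Matrix.diagonal b := by rw [h1, Matrix.mul_nonsing_inv G hG, Matrix.one_mul, Matrix.mul_one]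

/-- Transport along a bijection of index sets (pull back). -/
theorem comp_equiv {κ : Type} [Fintype κ] [DecidableEq κ] {b b' : κ → L} (h : IsomDiag L b b')
    (e : ι ≃ κ) : IsomDiag L (b ∘ e) (b' ∘ e) := by
  obtain ⟨G, hG, hE⟩ := h
  refine ⟨G.submatrix e e, by rwa [Matrix.det_submatrix_equiv_self], ?_⟩
  rw [cT_submatrix, ← Matrix.submatrix_diagonal_equiv, Matrix.submatrix_mul_equiv,
    Matrix.submatrix_mul_equiv, hE, Matrix.submatrix_diagonal_equiv]

/-- Transport along a bijection of index sets (push forward). -/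
theorem of_comp_equiv {κ : Type} [Fintype κ] [DecidableEq κ] {b b' : κ → L} (e : ι ≃ κ)
    (h : IsomDiag L (b ∘ e) (b' ∘ e)) : IsomDiag L b b' := by
  have h' := h.comp_equiv e.symm
  have hb : (b ∘ e) ∘ e.symm = b := by ext x; simp
  have hb' : (b' ∘ e) ∘ e.symm = b' := by ext x; simp
  rwa [hb, hb'] at h'

/-- Orthogonal sum of two isometries. -/
theorem sum {κ : Type} [Fintype κ] [DecidableEq κ] {b₁ b₁' : ι → L} {b₂ b₂' : κ → L}
    (h₁ : IsomDiag L b₁ b₁') (h₂ : IsomDiag L b₂ b₂') :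
    IsomDiag L (Sum.elim b₁ b₂) (Sum.elim b₁' b₂') := by
  obtain ⟨G₁, hG₁, e₁⟩ := h₁
  obtain ⟨G₂, hG₂, e₂⟩ := h₂
  refine ⟨Matrix.fromBlocks G₁ 0 0 G₂, ?_, ?_⟩
  · rw [Matrix.det_fromBlocks_zero₂₁]
    exact hG₁.mul hG₂
  · rw [cT_fromBlocks, cT_zero, cT_zero, ← Matrix.fromBlocks_diagonal, Matrix.fromBlocks_multiply,
      Matrix.fromBlocks_multiply, ← Matrix.fromBlocks_diagonal]
    simp [e₁, e₂]

/-- From `IsUnit G.det` to the general linear group: the `GL` form of an isometry. -/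
theorem exists_gl {b b' : ι → L} (h : IsomDiag L b b') :
    ∃ g : GL ι L, cT L (g : Matrix ι ι L) * Matrix.diagonal b * (g : Matrix ι ι L) = Matrix.diagonal b' := by
  obtain ⟨G, hG, e⟩ := h
  exact ⟨Matrix.nonsingInvUnit G hG, e⟩

/-- (Ported verbatim from the HodgeCMPerL package; no docstring in the source.) -/
theorem of_gl {b b' : ι → L} (g : GL ι L)
    (e : cT L (g : Matrix ι ι L) * Matrix.diagonal b * (g : Matrix ι ι L) = Matrix.diagonal b') :
    IsomDiag L b b' :=
  ⟨g, Matrix.isUnits_det_units g, e⟩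

end IsomDiag

end Algebra

/-! ## §2. Invariants of an isometry: discriminant class and positive index (inertia) -/

section Invariants

variable {ι : Type} [Fintype ι]

/-- The number of indices `i` at which `τ (b i)` has positive real part — for `σ`-fixed `b i` (so that
`τ (b i) ∈ ℝ^×`) this is the positive index of the real diagonal form `diag (τ b)` at the real place under `τ`. -/
def posCount (τ : L →+* ℂ) (b : ι → L) : ℕ := (Finset.univ.filter fun i => 0 < (τ (b i)).re).card

/-- (Ported verbatim from the HodgeCMPerL package; no docstring in the source.) -/
theorem posCount_eq_sum (τ : L →+* ℂ) (b : ι → L) :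
    posCount L τ b = ∑ i, (if 0 < (τ (b i)).re then 1 else 0) := by
  unfold posCount
  rw [Finset.card_filter]

/-- (Ported verbatim from the HodgeCMPerL package; no docstring in the source.) -/
theorem posCount_comp_equiv {κ : Type} [Fintype κ] (τ : L →+* ℂ) (b : κ → L) (e : ι ≃ κ) :
    posCount L τ (b ∘ e) = posCount L τ b := by
  rw [posCount_eq_sum, posCount_eq_sum]
  exact Fintype.sum_equiv e _ _ (fun x => rfl)

/-- (Ported verbatim from the HodgeCMPerL package; no docstring in the source.) -/
theorem posCount_sum_elim {κ : Type} [Fintype κ] (τ : L →+* ℂ) (b₁ : ι → L) (b₂ : κ → L) :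
    posCount L τ (Sum.elim b₁ b₂) = posCount L τ b₁ + posCount L τ b₂ := by
  rw [posCount_eq_sum, posCount_eq_sum, posCount_eq_sum, Fintype.sum_sum_type]
  rfl

/-- (Ported verbatim from the HodgeCMPerL package; no docstring in the source.) -/
theorem posCount_le_card (τ : L →+* ℂ) (b : ι → L) : posCount L τ b ≤ Fintype.card ι :=
  Finset.card_filter_le _ _ |>.trans (Finset.card_univ (α := ι)).le

/-- (Ported verbatim from the HodgeCMPerL package; no docstring in the source.) -/
theorem posCount_eq_card_iff (τ : L →+* ℂ) (b : ι → L) :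
    posCount L τ b = Fintype.card ι ↔ ∀ i, 0 < (τ (b i)).re := by
  unfold posCount
  rw [← Finset.card_univ, Finset.card_filter_eq_iff]
  simp

/-- (Ported verbatim from the HodgeCMPerL package; no docstring in the source.) -/
theorem posCount_eq_zero_iff (τ : L →+* ℂ) (b : ι → L) :
    posCount L τ b = 0 ↔ ∀ i, ¬ 0 < (τ (b i)).re := by
  unfold posCount
  rw [Finset.card_eq_zero, Finset.filter_eq_empty_iff]
  simp

/-- The real quadratic form `u ↦ Re ∑ dᵢ |uᵢ|²` on `ℂ^ι`. -/
def realQ (d : ι → ℂ) (u : ι → ℂ) : ℝ := ∑ i, (d i).re * ‖u i‖ ^ 2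

variable {L}
variable [DecidableEq ι]

/-- **Discriminant class.**  An isometry `ᵗ(σG)·diag b·G = diag b'` forces `∏ bᵢ = (∏ b'ᵢ) · N(z)` with
`z = (det G)⁻¹`. -/
theorem IsomDiag.disc {b b' : ι → L} (h : IsomDiag L b b') :
    ∃ z : L, z ≠ 0 ∧ ∏ i, b i = (∏ i, b' i) * (z * conjRingHomK L z) := by
  obtain ⟨G, hG, e⟩ := h
  have hD : G.det ≠ 0 := hG.ne_zero
  have edet : conjRingHomK L G.det * (∏ i, b i) * G.det = ∏ i, b' i := by
    have h := congrArg Matrix.det e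
    rwa [Matrix.det_mul, Matrix.det_mul, det_cT, Matrix.det_diagonal, Matrix.det_diagonal] at h
  refine ⟨G.det⁻¹, inv_ne_zero hD, ?_⟩
  have hσD : conjRingHomK L G.det ≠ 0 := (map_ne_zero _).mpr hD
  rw [map_inv₀, ← edet]
  field_simp

/-- (Ported verbatim from the HodgeCMPerL package; no docstring in the source.) -/
theorem re_star_dotProduct_diagonal_mulVec (d u : ι → ℂ) :
    (star u ⬝ᵥ (Matrix.diagonal d *ᵥ u)).re = realQ d u := by
  unfold realQ dotProduct
  rw [Complex.re_sum]
  refine Finset.sum_congr rfl fun i _ => ?_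
  rw [Matrix.mulVec_diagonal, Pi.star_apply, mul_left_comm, Complex.star_def, Complex.conj_mul']
  rw [← Complex.ofReal_pow, Complex.re_mul_ofReal]

/-- Change of variables: if `Gᴴ · diag d · G = diag d'` over `ℂ` then `realQ d (G u) = realQ d' u`. -/
theorem realQ_mulVec {d d' : ι → ℂ} {G : Matrix ι ι ℂ}
    (hG : Gᴴ * Matrix.diagonal d * G = Matrix.diagonal d') (u : ι → ℂ) :
    realQ d (G *ᵥ u) = realQ d' u := by
  rw [← re_star_dotProduct_diagonal_mulVec, ← re_star_dotProduct_diagonal_mulVec, Matrix.star_mulVec,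
    ← Matrix.dotProduct_mulVec, Matrix.mulVec_mulVec, Matrix.mulVec_mulVec, hG]

/-- An isometry over `L` gives, at every complex embedding `τ`, a complex congruence
`(τG)ᴴ · diag (τ b) · τG = diag (τ b')`. -/
theorem IsomDiag.map_embedding {b b' : ι → L} {G : Matrix ι ι L}
    (e : cT L G * Matrix.diagonal b * G = Matrix.diagonal b') (τ : L →+* ℂ) :
    (G.map τ)ᴴ * Matrix.diagonal (τ ∘ b) * G.map τ = Matrix.diagonal (τ ∘ b') := by
  have h := congrArg (fun M : Matrix ι ι L => M.map τ) e
  simp only [Matrix.map_mul, map_cT, Matrix.diagonal_map (map_zero τ)] at h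
  exact h

/-- Extension by zero from the coordinates in `S`. -/
def extZero (S : Finset ι) : ({i // i ∈ S} → ℂ) →ₗ[ℂ] (ι → ℂ) where
  toFun u i := if h : i ∈ S then u ⟨i, h⟩ else 0
  map_add' u v := by
    ext i
    by_cases h : i ∈ S <;> simp [h]
  map_smul' r u := by
    ext i
    by_cases h : i ∈ S <;> simp [h]

omit [Fintype ι] in
/-- (Ported verbatim from the HodgeCMPerL package; no docstring in the source.) -/
theorem extZero_apply_mem (S : Finset ι) (u : {i // i ∈ S} → ℂ) (i : {i // i ∈ S}) :
    extZero S u i = u i := by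
  simp [extZero, i.2]

omit [Fintype ι] in
/-- (Ported verbatim from the HodgeCMPerL package; no docstring in the source.) -/
theorem extZero_apply_not_mem (S : Finset ι) (u : {i // i ∈ S} → ℂ) {i : ι} (hi : i ∉ S) :
    extZero S u i = 0 := by
  simp [extZero, hi]

/-- **Sylvester's law of inertia (the inequality).**  A complex congruence `Gᴴ·diag d·G = diag d'` forces
`#{i | Re d'ᵢ > 0} ≤ #{i | Re dᵢ > 0}`: otherwise the positive coordinate space of `d'` (dimension `p'`)
would contain a non-zero vector whose image under `G` has vanishing `d`-positive coordinates (a kernel vector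
of a linear map to a space of dimension `p < p'`), on which the form is both `> 0` and `≤ 0`. -/
theorem card_pos_le_of_congr {d d' : ι → ℂ} {G : Matrix ι ι ℂ}
    (hG : Gᴴ * Matrix.diagonal d * G = Matrix.diagonal d') :
    (Finset.univ.filter fun i => 0 < (d' i).re).card ≤ (Finset.univ.filter fun i => 0 < (d i).re).card := by
  classical
  set P : Finset ι := Finset.univ.filter fun i => 0 < (d i).re with hP
  set P' : Finset ι := Finset.univ.filter fun i => 0 < (d' i).re with hP'
  have memP : ∀ i, i ∈ P ↔ 0 < (d i).re := fun i => by rw [hP]; simp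
  have memP' : ∀ i, i ∈ P' ↔ 0 < (d' i).re := fun i => by rw [hP']; simp
  by_contra hlt
  rw [not_le] at hlt
  -- the linear map  u ↦ (G · ext u)|_P  from ℂ^{P'} to ℂ^{P}
  let φ : ({i // i ∈ P'} → ℂ) →ₗ[ℂ] ({i // i ∈ P} → ℂ) :=
    (LinearMap.funLeft ℂ ℂ (Subtype.val : {i // i ∈ P} → ι)) ∘ₗ G.mulVecLin ∘ₗ extZero P'
  have hdim : Module.finrank ℂ ({i // i ∈ P} → ℂ) < Module.finrank ℂ ({i // i ∈ P'} → ℂ) := by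
    rw [Module.finrank_fintype_fun_eq_card, Module.finrank_fintype_fun_eq_card, Fintype.card_coe,
      Fintype.card_coe]
    exact hlt
  obtain ⟨u, hu, hu0⟩ := (Submodule.ne_bot_iff _).mp (LinearMap.ker_ne_bot_of_finrank_lt (f := φ) hdim)
  rw [LinearMap.mem_ker] at hu
  set w : ι → ℂ := extZero P' u with hw
  set v : ι → ℂ := G *ᵥ w with hv
  have hvP : ∀ i, i ∈ P → v i = 0 := by
    intro i hi
    have := congrFun hu ⟨i, hi⟩
    simpa [φ, LinearMap.funLeft_apply] using this
  -- the form is ≤ 0 on v …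
  have hle : realQ d v ≤ 0 := by
    refine Finset.sum_nonpos fun i _ => ?_
    by_cases hi : i ∈ P
    · rw [hvP i hi]; simp
    · have hdi : (d i).re ≤ 0 := not_lt.mp fun h => hi ((memP i).mpr h)
      exact mul_nonpos_of_nonpos_of_nonneg hdi (by positivity)
  -- … and > 0 on w
  have hgt : 0 < realQ d' w := by
    obtain ⟨j, hj⟩ : ∃ j : {i // i ∈ P'}, u j ≠ 0 := Function.ne_iff.mp hu0
    refine Finset.sum_pos' (fun i _ => ?_) ⟨j, Finset.mem_univ _, ?_⟩
    · by_cases hi : i ∈ P'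
      · have hdi : 0 < (d' i).re := (memP' i).mp hi
        exact mul_nonneg hdi.le (by positivity)
      · rw [hw, extZero_apply_not_mem P' u hi]; simp
    · have hdj : 0 < (d' j).re := (memP' j) |>.mp j.2
      rw [hw, extZero_apply_mem]
      exact mul_pos hdj (by positivity)
  have := realQ_mulVec hG w
  rw [← hv] at this
  linarith

/-- **Inertia.**  An isometry of diagonal hermitian forms over `L` preserves the positive index at every
complex embedding. -/
theorem IsomDiag.posCount_eq {b b' : ι → L} (h : IsomDiag L b b') (τ : L →+* ℂ) :
    posCount L τ b = posCount L τ b' := by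
  apply le_antisymm
  · obtain ⟨G, -, e⟩ := h.symm
    exact card_pos_le_of_congr (IsomDiag.map_embedding e τ)
  · obtain ⟨G, -, e⟩ := h
    exact card_pos_le_of_congr (IsomDiag.map_embedding e τ)

end Invariants

/-! ## §3. Real signs of `σ`-fixed elements; the binary move from the rank-2 theorem -/

section Binary

variable {L}

/-- (Ported verbatim from the HodgeCMPerL package; no docstring in the source.) -/
theorem re_mul_of_isReal {x : L} (hx : conjRingHomK L x = x) (y : L) (τ : L →+* ℂ) :
    (τ (x * y)).re = (τ x).re * (τ y).re := by
  rw [map_mul, Lemma33bLandherrProof.embedding_eq_re L hx τ, Complex.re_ofReal_mul]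
  simp

/-- (Ported verbatim from the HodgeCMPerL package; no docstring in the source.) -/
theorem re_inv_of_isReal {x : L} (hx : conjRingHomK L x = x) (τ : L →+* ℂ) :
    (τ x⁻¹).re = ((τ x).re)⁻¹ := by
  rw [map_inv₀, Lemma33bLandherrProof.embedding_eq_re L hx τ, ← Complex.ofReal_inv, Complex.ofReal_re]
  simp


-- port_pkg: scope closed for this part
end Binary
end LandherrRankN
end HodgeCM
end
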